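import Summits.BirchSwinnertonDyer.BirchSwinnertonDyer.Theses.KatoDescentTamePotSupersingular
import Literature.NumberTheory.EllipticCurves.KatoFineSelmerDualProofs
import HarnessLib

/-!
# Route `KatoDescentTamePotSupersingular` (rung K8, sub-rung B4 (t′), cell `bsd-potss`): the crux
# `TameFineSelmerCoatesSujatha` (item stmt-BirchSwinnertonDyer-19413) IS EXACTLY «the Pontryagin dual
# `Hom(Sel₀(ℚ_∞, E[p^∞]), ℚ/ℤ)` is finitely generated over `ℤ_p`» on its rows — the `∃ γ D` plumbing of the
# item DISCHARGED and the item shown DATUM-INDEPENDENT (a `--supports … --as helper` file; the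
# Conjecture-A content is NOT claimed and the item is NOT closed)

The tenure planner's rev-4 crux `TameFineSelmerCoatesSujatha` asks, on the non-CM irreducible
non-tower-surjective (t′) rank-`0` rows, for EVERY cyclotomic `ℤ_p`-extension `κ`:
`∃ γ (D : W.FineSelmerDualData κ γ), Module.Finite ℤ_[p] D.X` — "(∃-form over
`WeierstrassCurve.FineSelmerDualData`: construct the datum — plumbing, the fine analogue of
`WeierstrassCurve.selmerDualData` — and prove `ℤ_p`-finite generation, i.e. `μ(Y) = 0`, the content)".
The Literature proof file `KatoFineSelmerDualProofs` (this seat) CONSTRUCTS the datum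
`W.fineSelmerDualData κ hγ` (`X = Hom(Sel₀(K_∞, E[p^∞]), ℚ/ℤ)`, `Λ` acting with `T = γ − 1` for a
topological generator `γ`, which always exists). This file draws the consequences for the item:

* §1 `FineSelmerDualData.finite_restrictScalars_iff`: for ANY two data `D₁`, `D₂` (any `γ₁`, `γ₂`),
  `D₁.X` is finitely generated over `ℤ_p` iff `D₂.X` is — `D₂.toDual⁻¹ ∘ D₁.toDual` is a `ℤ_p`-LINEAR
  bijection (the `ℤ_p`-action on both sides is pinned on `p^k`-torsion
  classes by `toDual_C_smul`, and every class is `p`-power torsion), so the item's `∃ γ D` clause carries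
  no information beyond the canonical object: the item is WELL-POSED (datum-independent).
* §2 `tameFineSelmerCoatesSujatha_of_canonicalDual` / `tameFineSelmerCoatesSujatha_iff_canonicalDual`:
  **item 19413 ⟺ for every row `(W, p)` and every cyclotomic `κ` with topological generator `γ`, the
  canonical dual fine Selmer group `(W.fineSelmerDualData κ hγ).X = Hom(Sel₀(ℚ_∞, W[p^∞]), ℚ/ℤ)` is a
  finitely generated `ℤ_p`-module** — Coates–Sujatha's Conjecture A for `(W, p)` VERBATIM (Math. Ann. 331
  (2005) Conj. A: "`Y(E/F^cyc)` is a finitely generated `ℤ_p`-module"; Lim–Murty arXiv:1504.02522 §5: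
  for `F(E[p])/F` a `p`-extension it is equivalent to Iwasawa's `μ`-invariant conjecture for `F^cyc`),
  restricted to the rows. What is LEFT of the crux is therefore its content alone, a named open problem
  on a named family: `E[p]` irreducible with `Gal(ℚ(E[p])/ℚ)` a proper subgroup of `GL₂(𝔽_p)`
  (non-abelian: it contains a complex conjugation), where neither Wuthrich's Lemma 14 (rational
  `p`-isogeny) nor Ferrero–Washington applies.

CONDITIONAL / bookkeeping only (audit `proof.conditional` on §2's first theorem); nothing about
Conjecture A is asserted; NO item is closed. Seat `bsd-potss-k8t-c4` generation 2.

References: [CoatesSujatha2005] §3, Conjecture A, Thm. 3.4; [Lim2017FineSelmer] §3; Lim–Murty,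
arXiv:1504.02522 §5 (p. 8 of the held text); [GreenbergLNM1716] §1 (PDF p. 60); [Washington1997] §13.2.
-/

set_option autoImplicit false
-- sibling precedent (`KatoDescentPotSupersingularAssembly.lean`): the directory name repeats the summit name
set_option linter.dupNamespace false

noncomputable section

open scoped Classical

/-! ## §1 Datum independence: every dual fine Selmer datum is `ℤ_p`-linearly the canonical one -/

namespace WeierstrassCurve.FineSelmerDualData

open Literature.NumberTheory.EllipticCurves

variable {K : Type} [Field K] [NumberField K] {W : WeierstrassCurve K} {p : ℕ} [Fact p.Prime]
  {κ : ZpExtension K p}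

/-- **Datum independence of «`X₀` finitely generated over `ℤ_p`».** For ANY two dual fine Selmer data
`D₁ : W.FineSelmerDualData κ γ₁`, `D₂ : W.FineSelmerDualData κ γ₂` (any `γ₁`, `γ₂`): `D₁.X` is a finitely
generated `ℤ_p`-module iff `D₂.X` is. Indeed `D₂.toDual⁻¹ ∘ D₁.toDual : D₁.X ≃ D₂.X` (both `toDual` are
bijections onto `Hom(Sel₀(K_∞, E[p^∞]), ℚ/ℤ)`) is `ℤ_p`-LINEAR: on a class `s` with `p^k s = 0` (every class
is `p`-power torsion, `exists_pow_smul_subgroupH1_ker_eq_zero`) both `ℤ_p`-actions read `c ↦ (c mod p^k)`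
by `toDual_C_smul`. In particular the item's `∃ γ D` clause carries no information beyond the canonical
object `W.fineSelmerDualData κ hγ` (file `KatoFineSelmerDualProofs`).
[cite: CoatesSujatha2005, §3 (the dual fine Selmer group as a Λ(Γ)-module)] [cite: GreenbergLNM1716, §1 (after Conj. 1.3)] -/
theorem finite_restrictScalars_iff {γ₁ γ₂ : Field.absoluteGaloisGroup K}
    (D₁ : W.FineSelmerDualData κ γ₁) (D₂ : W.FineSelmerDualData κ γ₂) :
    Module.Finite ℤ_[p] (RestrictScalars ℤ_[p] (IwasawaAlgebra p) D₁.X) ↔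
      Module.Finite ℤ_[p] (RestrictScalars ℤ_[p] (IwasawaAlgebra p) D₂.X) := by
  -- the additive equivalence `D₂.toDual⁻¹ ∘ D₁.toDual`
  let e₀ : D₁.X ≃+ D₂.X :=
    (AddEquiv.ofBijective (D₁.toDual : D₁.X →+ (W.fineSelmerInfty κ →+ AddCircle (1 : ℚ))) D₁.bijective).trans
      (AddEquiv.ofBijective (D₂.toDual : D₂.X →+ (W.fineSelmerInfty κ →+ AddCircle (1 : ℚ)))
        D₂.bijective).symm
  have he₀ : ∀ x : D₁.X, D₂.toDual (e₀ x) = D₁.toDual x := fun x ↦ by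
    show (AddEquiv.ofBijective (D₂.toDual : D₂.X →+ (W.fineSelmerInfty κ →+ AddCircle (1 : ℚ)))
        D₂.bijective) (e₀ x) = _
    exact AddEquiv.apply_symm_apply _ _
  -- `ℤ_p`-linearity on the nose: both actions are pinned on `p^k`-torsion classes
  have hsmul : ∀ (c : ℤ_[p]) (x : D₁.X),
      e₀ ((PowerSeries.C c : IwasawaAlgebra p) • x) = (PowerSeries.C c : IwasawaAlgebra p) • e₀ x :=
    fun c x ↦ by
    apply D₂.bijective.1
    rw [he₀]
    ext s
    obtain ⟨k, hk⟩ : ∃ k : ℕ, p ^ k • s = 0 := by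
      obtain ⟨k, hk⟩ := W.exists_pow_smul_subgroupH1_ker_eq_zero κ (s : W.subgroupH1 p κ.kerSubgroup)
      exact ⟨k, Subtype.ext (by rw [AddSubgroupClass.coe_nsmul]; exact hk)⟩
    rw [D₁.toDual_C_smul c x s k hk, D₂.toDual_C_smul c (e₀ x) s k hk, he₀]
  -- as a `ℤ_p`-linear equivalence of the scalar restrictions
  let e : RestrictScalars ℤ_[p] (IwasawaAlgebra p) D₁.X ≃ₗ[ℤ_[p]]
      RestrictScalars ℤ_[p] (IwasawaAlgebra p) D₂.X :=
    AddEquiv.toLinearEquiv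
      (e₀ : RestrictScalars ℤ_[p] (IwasawaAlgebra p) D₁.X ≃+ RestrictScalars ℤ_[p] (IwasawaAlgebra p) D₂.X)
      fun c x ↦ by
        rw [RestrictScalars.smul_def, RestrictScalars.smul_def, ← PowerSeries.C_eq_algebraMap]
        exact hsmul c x
  exact ⟨fun _ ↦ Module.Finite.equiv e, fun _ ↦ Module.Finite.equiv e.symm⟩

end WeierstrassCurve.FineSelmerDualData

/-! ## §2 Item 19413 ⟺ Conjecture A verbatim on the canonical dual, on its rows -/

namespace Summit.BirchSwinnertonDyer.BirchSwinnertonDyer.Theorems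

open WeierstrassCurve Literature.NumberTheory.EllipticCurves
  Literature.NumberTheory.EllipticCurves.Rank1Residual
  Summit.BirchSwinnertonDyer.Rank1Residual.Additive
  Summit.BirchSwinnertonDyer.BirchSwinnertonDyer.Theses.KatoDescentTamePotSupersingular

/-- **The crux `TameFineSelmerCoatesSujatha` (item 19413) FROM Conjecture A on the CANONICAL dual**: if on
every row of the item (globally minimal `W`, `r_an = 0`, odd additive (t′) `p`, `E[p]` irreducible,
tower not onto, no CM) and for every cyclotomic `κ` with topological generator `γ` the canonical dual fine
Selmer group `Hom(Sel₀(ℚ_∞, W[p^∞]), ℚ/ℤ)` (`(W.fineSelmerDualData κ hγ).X`) is finitely generated over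
`ℤ_p`, the item holds — its `∃ γ D` witnessed by the constructed datum (a topological generator exists
since `κ` is onto `ℤ_p ∋ 1`). The ∃-plumbing of the item is thereby DISCHARGED; its Conjecture-A content
is the displayed hypothesis and is NOT claimed. [cite: CoatesSujatha2005, §3 and Conjecture A]
[cite: GreenbergLNM1716, §1 (after Conj. 1.3)] -/
theorem tameFineSelmerCoatesSujatha_of_canonicalDual
    (hA : ∀ (W : WeierstrassCurve ℚ) [W.IsElliptic] [W.IsGloballyMinimal] (p : ℕ) [Fact p.Prime],
      W.analyticRank = 0 → p ≠ 2 → Addv W p → SubTprime W p → W.HasIrreducibleModPGaloisRep p →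
      ¬ (∀ n : ℕ, W.HasSurjectiveModNGaloisRep (p ^ n : ℕ)) → ¬ W.HasCM →
      ∀ (κ : ZpExtension ℚ p), κ.IsCyclotomic → ∀ (γ : Field.absoluteGaloisGroup ℚ)
        (hγ : κ.IsTopGenerator γ),
        Module.Finite ℤ_[p] (RestrictScalars ℤ_[p] (IwasawaAlgebra p) (W.fineSelmerDualData κ hγ).X)) :
    Summit.BirchSwinnertonDyer.BirchSwinnertonDyer.Theses.KatoDescentTamePotSupersingular.TameFineSelmerCoatesSujatha := by
  intro W _ _ p _ hr hp2 hadd hT hI hns hcm κ hκ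
  obtain ⟨γ, hγ⟩ : ∃ γ : Field.absoluteGaloisGroup ℚ, κ.IsTopGenerator γ :=
    κ.surjective (Multiplicative.ofAdd 1)
  exact ⟨γ, W.fineSelmerDualData κ hγ, hA W p hr hp2 hadd hT hI hns hcm κ hκ γ hγ⟩

/-- **Item 19413 ⟺ Coates–Sujatha's Conjecture A VERBATIM on the canonical dual, on the item's rows**:
`TameFineSelmerCoatesSujatha` holds iff for every row `(W, p)` and every cyclotomic `κ` with topological
generator `γ`, `Hom(Sel₀(ℚ_∞, W[p^∞]), ℚ/ℤ)` is a finitely generated `ℤ_p`-module ("`Y(E/ℚ^cyc)` is a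
finitely generated `ℤ_p`-module", Coates–Sujatha Conj. A; by Lim–Murty §5 / Coates–Sujatha Thm. 3.4 it
follows from Iwasawa's `μ`-invariant conjecture for the cyclotomic `ℤ_p`-extension of `ℚ(W[p])`). Forward
direction by datum independence (§1), backward by the constructed datum. So the crux is EXACTLY its
content: a named open problem on the named family of rows (census: 411 non-CM pairs at `p ∈ {3,5,7}`,
`N < 5·10⁵`); nothing about it is asserted here. [cite: CoatesSujatha2005, Conjecture A and Thm. 3.4]
[cite: Lim2017FineSelmer, §3] -/
theorem tameFineSelmerCoatesSujatha_iff_canonicalDual :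
    Summit.BirchSwinnertonDyer.BirchSwinnertonDyer.Theses.KatoDescentTamePotSupersingular.TameFineSelmerCoatesSujatha ↔
      ∀ (W : WeierstrassCurve ℚ) [W.IsElliptic] [W.IsGloballyMinimal] (p : ℕ) [Fact p.Prime],
        W.analyticRank = 0 → p ≠ 2 → Addv W p → SubTprime W p → W.HasIrreducibleModPGaloisRep p →
        ¬ (∀ n : ℕ, W.HasSurjectiveModNGaloisRep (p ^ n : ℕ)) → ¬ W.HasCM →
        ∀ (κ : ZpExtension ℚ p), κ.IsCyclotomic → ∀ (γ : Field.absoluteGaloisGroup ℚ)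
          (hγ : κ.IsTopGenerator γ),
          Module.Finite ℤ_[p] (RestrictScalars ℤ_[p] (IwasawaAlgebra p) (W.fineSelmerDualData κ hγ).X) := by
  refine ⟨fun hCS W _ _ p _ hr hp2 hadd hT hI hns hcm κ hκ γ hγ ↦ ?_,
    tameFineSelmerCoatesSujatha_of_canonicalDual⟩
  obtain ⟨γ', D, hD⟩ := hCS W p hr hp2 hadd hT hI hns hcm κ hκ
  exact (D.finite_restrictScalars_iff (W.fineSelmerDualData κ hγ)).mp hD

end Summit.BirchSwinnertonDyer.BirchSwinnertonDyer.Theorems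

end
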